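import Summits.QuantumFields.BalabanUV.T4Continuum.Support.InsertionChannelFamilyLinearBinders
import Summits.QuantumFields.BalabanUV.T4Continuum.Support.InsertionChannelEndArithmetic

/-!
# InsertionChannelFamilyArithmetic — NE5 ∕ U3: the channel road's ENDs ON ROAD D (leaf-06-g12's `InsertionChannelFamily*`, parts 2 and 4)
# WITH THE ARITHMETIC LETTERS ELIMINATED — part 2's `ne5_of_pointwiseSlots_pieceChannel_lip_nat` (p228521; printed-count letters, W2 as
# `DataLipschitz`: letters `k₀, B`) and part 4's `ne5_of_pointwiseSlots_insLin_fibre_scale_nat` (p229246; linear-extension insertion, FIBRE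
# envelopes, general letters `c, ω`: letters `ρ₀, k₀, B`) — `OutputRateArithmetic.reach_binders_exists` (p207722),
# `B13StepEndArithmetic.reach_elim_iff` (p210647), `InsertionChannelEndArithmetic.rateWindow_nonempty_iff` (p219563) BY NAME; per slot
# package (`exists_…`), `∃ C₅` OUTERMOST from the sizes (`uniform_…`), the rate-window faces (`exists_rate_lt_one_…`), and part 2's letters
# decided sharply (`lipRoad_letters_count124_iff`)

Cell `pub-balaban`, unit `b2b-balaban-t4-ne5-formalise-leaf-10` (NE5 formalisation swarm, LEAF PROVER 10, gen 10; row O6-n NUMERICS =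
leaves L10∕L11 of `SKELETON-NE5-P1`; lineage FOLLOWER under CLAIM RULE 1∕3 — the letters-free twin of a NEW END face carrying the
arithmetic binders, this lineage's standing pattern: `B13StepEndArithmetic` p210647, `InsertionChannelEndArithmetic` p219563,
`OutputRateTowerArithmetic` p220788; OFFERED as a draft at gen 9 (990adadab882fb12), leaf-06-g12 «GO — NOT MINE» `CLAIMS.log` l.18215;
journal INTENT this gen).  Imports part 4 `InsertionChannelFamilyLinearBinders` (hence parts 1–3) + `InsertionChannelEndArithmetic` (hence
`B13StepEndArithmetic`, `OutputRateArithmetic`) ONLY; 0 `def`, 0 cite tag; Summits-side bookkeeping under the LEAN PLACEMENT RULE (NOT a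
Literature module); nothing landed is edited — parts 2∕4's ENDs and this lineage's arithmetic lemmas are applied BY NAME.
HONEST FRAMING: rung (B)+1 of the FINITE-VOLUME T⁴ continuum programme — NOT infinite volume, NOT a mass gap, NOT the Clay problem,
and **NOT A PROOF OF NE5** (NOT PRINTED; GAPS G-t4-U3-1) nor of NE9: every END below is an IMPLICATION whose wall binders (the
representation of the two runs' function tables at every chart point, admissibility, W1 per chart point `hop`, W2 as the model-level
`DataLipschitz W κ Λ ρ₀` (part 2) or the two FIBRE envelopes `OpFibreEnvelope ∕ HistFibreEnvelope` of constant `G` (part 4), the decay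
levels L05∕L06 — [Balaban1987RG1] (1.18) p. 263, SHAPE only —, W4 `hinsRate`, the insertion IS the piece channel's (part 2) ∕ the
linear-extension insertion `insLinOfChannel` of an additive homogeneous local channel (part 4), row NE9's `SrcScale ∕ PieceBound ∕
LevelCounts` (S5; NOT printed, NOT proved) ∕ the channel's size binder + weight dictionary) are DISPLAYED HYPOTHESES asserted nowhere.
HONEST DEPENDENCY (cell line, verbatim): continuum YM on T⁴ ⇐ BetaPertH ∧ nine spine estimates (0/9 proved); BetaPertH ⇐ (D1) ∧ (D4) ∧
CAP+tail; G-an2-4 gates asym, D1 and NE2/3/4.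

THE POINT (decls, not adjectives).  Part 2's Road-D END `ne5_of_pointwiseSlots_pieceChannel_lip_nat` carries, besides its wall binders,
the reach scale `k₀` and the first-scales constant `B` with `hnear : (δ + δ′)·θ^{k₀} + (6L)⁴(EA₀ + E₀)∕(1 − L⁻¹) ≤ ρ₀`, `hB : 0 ≤ B`,
`hfirst : ∀ k < k₀, EA₀ + E₀ ≤ B·θ^k`, and the smallness `hsmall : Λ < (θ′ − L⁻¹)∕(6L)⁴` (owner R30 (iii)); here `ρ₀` is W2's ANALYTIC
`DataLipschitz` radius and `Λ` its modulus — they STAY (as on the tower road, `OutputRateTowerArithmetic`).  For an input rate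
`0 < θ < 1` the letters `k₀, B` EXIST as soon as the ONE strict reach `(6L)⁴·(EA₀ + E₀)∕(1 − L⁻¹) < ρ₀` holds
(`reach_binders_exists` with `D := δ + δ′`, `c := (6L)⁴`, `ω := L⁻¹`), and — when the input-rate constant `δ + δ′` is positive — ONLY
then (`OutputRateArithmetic.reach_necessary`); the target rate `θ′ < 1` exists iff moreover `L⁻¹ + Λ·(6L)⁴ < 1`
(`OutputRateArithmetic.rate_window_iff`).  So on this road the two strict SIZE inequalities of record read
**`(6L)⁴·(EA₀ + E₀)∕(1 − L⁻¹) < ρ₀`** (REACH, L10) and **`L⁻¹ + Λ·(6L)⁴ < θ′ ≤ 1`** (SMALLNESS, L11) — the census VALUES of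
`B13SmallnessCensus.md` are unchanged (symbolic: `ρ₀, Λ` not printed; `EA₀, E₀` the (1.18)-levels in slice units; 0∕12).

WHAT THIS FILE DOES ([folklore] bookkeeping; 0 sorry; axioms ⊆ {propext, Classical.choice, Quot.sound}).
* §1 `lipRoad_letters_count124_iff` — the letters of part 2's END LITERALLY (`θ ≤ θ′ < 1`, `k₀`, `B`, `hnear`, `hB`, `hfirst`, `hsmall`)
  are jointly satisfiable IFF `(6L)⁴(EA₀ + E₀)∕(1 − L⁻¹) < ρ₀ ∧ L⁻¹ + Λ(6L)⁴ < 1` (input-rate constant `0 < δ + δ′`, rate `0 < θ < 1`).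
* §2 `exists_ne5_of_pointwiseSlots_pieceChannel_lip` — part 2's END with `{k₀ B} hnear hB hfirst` REPLACED by `0 < θ < 1` and the strict
  reach; every other binder VERBATIM; conclusion `∃ C₅, T4OutputRate.NE5 EA EB W κ θ′ C₅` over the ORIGINAL carriers `C`;
  `exists_rate_lt_one_of_pointwiseSlots_pieceChannel_lip` — the RATE-WINDOW face: `(6L)⁴(EA₀ + E₀)∕(1 − L⁻¹) < ρ₀` and
  `L⁻¹ + Λ(6L)⁴ < 1` ⟹ `∃ θ′ < 1, ∃ C₅, NE5 EA EB W κ θ′ C₅`.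
* §3 `uniform_ne5_of_pointwiseSlots_pieceChannel_lip` — `∃ C₅` OUTERMOST: ONE constant from the sizes `L, Λ, EA₀, E₀, δ + δ′, θ, θ′, ρ₀`
  serving EVERY carrier package `C`, chart `𝒰` onto the run-B backgrounds, history frame, operator space, per-background slots `P`,
  piece data, output indexing, window `W`, pair of runs `EA ∕ EB` and decay rate `κ` meeting part 2's binders.
* §4 part 4's END (FIBRE road, general letters `c, ω`): `exists_ne5_of_pointwiseSlots_insLin_fibre_scale` — the FIVE binders over
  `ρ₀, k₀, B` (`hρ₀`, `hnear`, `hB`, `hfirst`, the `G`-form smallness `ω + G∕(1 − ρ₀)·c < θ′`) REPLACED by `0 < θ < 1`, `ω < 1` and the two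
  strict size inequalities `c(EA₀ + E₀) < 1 − ω`, `ω + G·c·(1 − ω)∕(1 − ω − c(EA₀ + E₀)) < θ′` (the pattern of
  `InsertionChannelEndArithmetic.exists_ne5_of_stepModel_fibre_evalChannel_nat`); `exists_rate_lt_one_of_pointwiseSlots_insLin_fibre_scale` —
  the reach face `c·(G + EA₀ + E₀) < 1 − ω ⟹ ∃ θ′ < 1, θ ≤ θ′ ∧ ∃ C₅, NE5 …`; `uniform_ne5_of_pointwiseSlots_insLin_fibre_scale` — `∃ C₅`
  OUTERMOST from the sizes `c, ω, G, EA₀, E₀, δ + δ′, θ, θ′`.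
NOT claimed: any estimate; any value of `ρ₀, Λ, G, c, ω, EA₀, E₀, δ, δ′`; that Bałaban's step or [II]'s pieces satisfy a binder; NE5; NE9.
Headline wording (owner R30 (ii) ∕ R35, c5): «NE5 channel road on Road D — arithmetic letters eliminated (junction bookkeeping)»;
never «leaf instantiated»; 0∕12; spine 0∕9.
-/

noncomputable section

open scoped BigOperators
open Finset Function Metric Set

namespace Summit.QuantumFields.BalabanUV.T4Continuum.InsertionChannelFamilyArithmetic

open Literature.MathematicalPhysics.QuantumFieldTheory.Balaban1983to89
open Literature.MathematicalPhysics.QuantumFieldTheory.Balaban1983to89.T4OutputRate (Carriers Functional DecayBound NE5)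
open Literature.MathematicalPhysics.QuantumFieldTheory.Balaban1983to89.T4HistoryLipschitzRecursion
  (ChannelAdditive ChannelLocal ChannelStepSum ChannelSizeAtStepNN)
open Summit.QuantumFields.BalabanUV.T4Continuum.B13HistDatum (HistFrame Hist)
open Summit.QuantumFields.BalabanUV.T4Continuum.NE9Lemma1Counting (PieceData pieceChannel SrcScale PieceBound LevelCounts weightOf
  ellPrinted)
open Summit.QuantumFields.BalabanUV.T4Continuum.InsertionChannelReading (ChannelHomog)
open Summit.QuantumFields.BalabanUV.T4Continuum.OutputRateFunctionalTables
open Summit.QuantumFields.BalabanUV.T4Continuum.OutputRateFunctionalTablesPointwise (PointwiseSlots)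
open Summit.QuantumFields.BalabanUV.T4Continuum.InsertionChannelFamily (insAtOfChannel insLinOfChannel
  ne5_of_pointwiseSlots_pieceChannel_lip_nat ne5_of_pointwiseSlots_insLin_fibre_scale_nat)
open Summit.QuantumFields.BalabanUV.T4Continuum.OutputRateArithmetic (reach_binders_exists reach_necessary rate_window_iff)
open Summit.QuantumFields.BalabanUV.T4Continuum.B13StepEndArithmetic (reach_elim_iff smallness_of_gain)
open Summit.QuantumFields.BalabanUV.T4Continuum.InsertionChannelEndArithmetic (rateWindow_nonempty_iff)

/-! ## §1 The letters of the Road-D channel END at the printed-count letters, decided sharply -/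

section Letters

/-- [folklore] **THE LETTERS OF PART 2's ROAD-D END ARE JOINTLY SATISFIABLE IFF TWO STRICT SIZE INEQUALITIES HOLD.**  For an input
rate `0 < θ < 1`, a positive input-rate constant `D` (`= δ + δ′`) and `1 < L`: some target rate `θ ≤ θ′ < 1`, reach scale `k₀` and
first-scales constant `B ≥ 0` with `hnear : D·θ^{k₀} + (6L)⁴(EA₀ + E₀)∕(1 − L⁻¹) ≤ ρ₀`, `hfirst : ∀ k < k₀, EA₀ + E₀ ≤ B·θ^k` and
`hsmall : Λ < (θ′ − L⁻¹)∕(6L)⁴` — LITERALLY the binders of `InsertionChannelFamily.ne5_of_pointwiseSlots_pieceChannel_lip_nat` —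
exist IFF `(6L)⁴(EA₀ + E₀)∕(1 − L⁻¹) < ρ₀` and `L⁻¹ + Λ(6L)⁴ < 1`. -/
theorem lipRoad_letters_count124_iff {L D θ Λ EA₀ E₀ ρ₀ : ℝ} (hL : 1 < L) (hD : 0 < D) (hθ0 : 0 < θ) (hθ1 : θ < 1) :
    (∃ θ' : ℝ, ∃ k₀ : ℕ, ∃ B : ℝ, θ ≤ θ' ∧ θ' < 1 ∧ 0 ≤ B ∧
        D * θ ^ k₀ + (6 * L) ^ 4 * (EA₀ + E₀) / (1 - L⁻¹) ≤ ρ₀ ∧ (∀ k < k₀, EA₀ + E₀ ≤ B * θ ^ k) ∧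
        Λ < (θ' - L⁻¹) / (6 * L) ^ 4) ↔
      ((6 * L) ^ 4 * (EA₀ + E₀) / (1 - L⁻¹) < ρ₀ ∧ L⁻¹ + Λ * (6 * L) ^ 4 < 1) := by
  have hc : 0 < (6 * L) ^ 4 := by positivity
  constructor
  · rintro ⟨θ', k₀, B, -, hθ'1, -, hnear, -, hsmall⟩
    refine ⟨reach_necessary hD hθ0 hnear, ?_⟩
    have h1 : Λ * (6 * L) ^ 4 < θ' - L⁻¹ := (lt_div_iff₀ hc).1 hsmall
    linarith
  · rintro ⟨hreach, hwin⟩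
    obtain ⟨θ', hθθ', hθ'1, hs⟩ := (rate_window_iff (θ := θ) (s := L⁻¹ + Λ * (6 * L) ^ 4)).2 ⟨hθ1, hwin⟩
    obtain ⟨k₀, B, hB, hnear, hfirst⟩ := reach_binders_exists (c := (6 * L) ^ 4) (ω := L⁻¹) hD.le hθ0 hθ1 hreach
    exact ⟨θ', k₀, B, hθθ', hθ'1, hB, hnear, hfirst, (lt_div_iff₀ hc).2 (by linarith)⟩

end Letters

/-! ## §2 Part 2's Road-D END with the letters eliminated, per slot package; the rate-window face -/

section End

variable {C : Carriers} {𝒰 ι : Type} {F : HistFrame C}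
variable {α β γ : Type} {Op : Type*} [NormedAddCommGroup Op] [NormedSpace ℂ Op] (P : PointwiseSlots C 𝒰 Op (Hist F))
  {Pc : PieceData C 𝒰 ι α β γ} {out : 𝒰 → F.Idx → ι} {W : Set (ℕ → ℝ)}

/-- [folklore] **THE CHANNEL ROAD's END ON ROAD D AT THE PRINTED-COUNT LETTERS, ARITHMETIC LETTERS ELIMINATED** — part 2's
`InsertionChannelFamily.ne5_of_pointwiseSlots_pieceChannel_lip_nat` (p228521) with `k₀, B, hnear, hB, hfirst` replaced by `0 < θ < 1`
and the strict reach `(6L)⁴·(EA₀ + E₀)∕(1 − L⁻¹) < ρ₀` (`ρ₀` = W2's analytic `DataLipschitz` radius, kept); every other binder VERBATIM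
(representation of the two runs' function tables at every chart point with the inserted families bounded over the chart, admissibility,
W2 `DataLipschitz W κ Λ ρ₀`, the decay levels, W1 `hop`, W4 `hinsRate`, the insertion IS the piece channel's, row NE9's displayed
`SrcScale ∕ PieceBound ∕ LevelCounts`, signs, weight dictionary, `Λ < (θ′ − L⁻¹)∕(6L)⁴`); conclusion `∃ C₅, NE5 EA EB W κ θ′ C₅` over
the ORIGINAL carriers.  NOT a proof of NE5 ∕ NE9: an implication from displayed binders. -/
theorem exists_ne5_of_pointwiseSlots_pieceChannel_lip [Nonempty 𝒰] {ρ : 𝒰 → C.BgB} (hρ : Surjective ρ) {EA : Functional C C.BgA}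
    {EB : Functional C C.BgB} {κ κ₁ d0 O1 L Λ EA₀ E₀ δ δ' θ θ' ρ₀ : ℝ} {Kp : ℕ → ι → ℝ} (hL : 1 < L)
    (hbdA : ∀ g ∈ W, ∀ k, BddAbove (Set.range fun u => ‖P.insA g k (uncurry (funTableA ρ EA g)) u‖))
    (hbdB : ∀ g ∈ W, ∀ k, BddAbove (Set.range fun u => ‖P.insB g k (uncurry (funTableB ρ EB g)) u‖))
    (hrA : ∀ g ∈ W, ∀ (X : C.Dom) (u : 𝒰), EA g (C.transport (ρ u)) X =
      (P.Out (C.scale X) (P.opA g (C.scale X) u) (P.insA g (C.scale X) (uncurry (funTableA ρ EA g)) u) X).re)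
    (hrB : ∀ g ∈ W, ∀ (X : C.Dom) (u : 𝒰), EB g (ρ u) X =
      (P.Out (C.scale X) (P.opB g (C.scale X) u) (P.insB g (C.scale X) (uncurry (funTableB ρ EB g)) u) X).re)
    (hbase : ∀ k, ∀ g ∈ W, ∀ u, (P.opB g k u, P.insB g k (uncurry (funTableB ρ EB g)) u) ∈ P.Base k g u)
    (hlip : P.toStepModel.DataLipschitz W κ Λ ρ₀) (hdA : DecayBound EA W EA₀ κ) (hdB : DecayBound EB W E₀ κ)
    (hop : ∀ k, ∀ g ∈ W, ∀ u : 𝒰, ‖P.opA g k u - P.opB g k u‖ ≤ δ * θ ^ k * P.rOp k)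
    (hinsRate : ∀ k, ∀ g ∈ W, ∀ (t : C.Dom × 𝒰 → ℝ), (∀ Y u, |t (Y, u)| ≤ E₀ * Real.exp (-(κ * C.d Y))) →
      ∀ u, ‖P.insA g k t u - P.insB g k t u‖ ≤ δ' * θ ^ k * P.rHist k)
    (hins : ∀ k, ∀ g ∈ W, ∀ (t : C.Dom × 𝒰 → ℝ) (u : 𝒰), P.insA g k t u = insAtOfChannel (pieceChannel Pc) out g k t u)
    (hsrc : SrcScale Pc) (hPiece : PieceBound Pc κ κ₁ d0 Kp (ellPrinted L)) (hLev : LevelCounts Pc κ κ₁ O1 L (ellPrinted L))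
    (hKp : ∀ k y, 0 ≤ Kp k y) (hO1 : 0 ≤ O1) (hwt : ∀ k u i, weightOf Pc κ₁ d0 O1 Kp k (out u i) ≤ P.rHist (k + 1) * F.wt i)
    (hΛ : 0 ≤ Λ) (hδ : 0 ≤ δ + δ') (hθ0 : 0 < θ) (hθ1 : θ < 1) (hθθ' : θ ≤ θ') (hθ'1 : θ' ≤ 1)
    (hreach : (6 * L) ^ 4 * (EA₀ + E₀) / (1 - L⁻¹) < ρ₀) (hsmall : Λ < (θ' - L⁻¹) / (6 * L) ^ 4) :
    ∃ C₅, NE5 EA EB W κ θ' C₅ := by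
  obtain ⟨k₀, B, hB, hnear, hfirst⟩ := reach_binders_exists (D := δ + δ') (θ := θ) hδ hθ0 hθ1 hreach
  exact ⟨_, ne5_of_pointwiseSlots_pieceChannel_lip_nat P hρ hL hbdA hbdB hrA hrB hbase hlip hdA hdB hop hinsRate hins hsrc hPiece
    hLev hKp hO1 hwt hΛ hδ hθ0.le hθθ' hθ'1 hnear hB hfirst hsmall⟩

/-- [folklore] **THE RATE-WINDOW FACE ON ROAD D** — for EVERY input rate `0 < θ < 1`: if the strict reach
`(6L)⁴·(EA₀ + E₀)∕(1 − L⁻¹) < ρ₀` and the letter-free smallness `L⁻¹ + Λ·(6L)⁴ < 1` hold, then SOME target rate `θ′ < 1` (with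
`θ ≤ θ′`) and constant `C₅` give `NE5 EA EB W κ θ′ C₅` — part 2's END with `θ′, k₀, B, hnear, hB, hfirst, hsmall` ALL eliminated
(`OutputRateArithmetic.rate_window_iff` + `exists_ne5_of_pointwiseSlots_pieceChannel_lip`); every wall binder VERBATIM. -/
theorem exists_rate_lt_one_of_pointwiseSlots_pieceChannel_lip [Nonempty 𝒰] {ρ : 𝒰 → C.BgB} (hρ : Surjective ρ)
    {EA : Functional C C.BgA} {EB : Functional C C.BgB} {κ κ₁ d0 O1 L Λ EA₀ E₀ δ δ' θ ρ₀ : ℝ} {Kp : ℕ → ι → ℝ} (hL : 1 < L)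
    (hbdA : ∀ g ∈ W, ∀ k, BddAbove (Set.range fun u => ‖P.insA g k (uncurry (funTableA ρ EA g)) u‖))
    (hbdB : ∀ g ∈ W, ∀ k, BddAbove (Set.range fun u => ‖P.insB g k (uncurry (funTableB ρ EB g)) u‖))
    (hrA : ∀ g ∈ W, ∀ (X : C.Dom) (u : 𝒰), EA g (C.transport (ρ u)) X =
      (P.Out (C.scale X) (P.opA g (C.scale X) u) (P.insA g (C.scale X) (uncurry (funTableA ρ EA g)) u) X).re)
    (hrB : ∀ g ∈ W, ∀ (X : C.Dom) (u : 𝒰), EB g (ρ u) X =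
      (P.Out (C.scale X) (P.opB g (C.scale X) u) (P.insB g (C.scale X) (uncurry (funTableB ρ EB g)) u) X).re)
    (hbase : ∀ k, ∀ g ∈ W, ∀ u, (P.opB g k u, P.insB g k (uncurry (funTableB ρ EB g)) u) ∈ P.Base k g u)
    (hlip : P.toStepModel.DataLipschitz W κ Λ ρ₀) (hdA : DecayBound EA W EA₀ κ) (hdB : DecayBound EB W E₀ κ)
    (hop : ∀ k, ∀ g ∈ W, ∀ u : 𝒰, ‖P.opA g k u - P.opB g k u‖ ≤ δ * θ ^ k * P.rOp k)
    (hinsRate : ∀ k, ∀ g ∈ W, ∀ (t : C.Dom × 𝒰 → ℝ), (∀ Y u, |t (Y, u)| ≤ E₀ * Real.exp (-(κ * C.d Y))) →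
      ∀ u, ‖P.insA g k t u - P.insB g k t u‖ ≤ δ' * θ ^ k * P.rHist k)
    (hins : ∀ k, ∀ g ∈ W, ∀ (t : C.Dom × 𝒰 → ℝ) (u : 𝒰), P.insA g k t u = insAtOfChannel (pieceChannel Pc) out g k t u)
    (hsrc : SrcScale Pc) (hPiece : PieceBound Pc κ κ₁ d0 Kp (ellPrinted L)) (hLev : LevelCounts Pc κ κ₁ O1 L (ellPrinted L))
    (hKp : ∀ k y, 0 ≤ Kp k y) (hO1 : 0 ≤ O1) (hwt : ∀ k u i, weightOf Pc κ₁ d0 O1 Kp k (out u i) ≤ P.rHist (k + 1) * F.wt i)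
    (hΛ : 0 ≤ Λ) (hδ : 0 ≤ δ + δ') (hθ0 : 0 < θ) (hθ1 : θ < 1)
    (hreach : (6 * L) ^ 4 * (EA₀ + E₀) / (1 - L⁻¹) < ρ₀) (hwin : L⁻¹ + Λ * (6 * L) ^ 4 < 1) :
    ∃ θ' < 1, θ ≤ θ' ∧ ∃ C₅, NE5 EA EB W κ θ' C₅ := by
  have hc : 0 < (6 * L) ^ 4 := by have : 0 < L := by linarith
                                  positivity
  obtain ⟨θ', hθθ', hθ'1, hs⟩ := (rate_window_iff (θ := θ) (s := L⁻¹ + Λ * (6 * L) ^ 4)).2 ⟨hθ1, hwin⟩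
  exact ⟨θ', hθ'1, hθθ', exists_ne5_of_pointwiseSlots_pieceChannel_lip P hρ hL hbdA hbdB hrA hrB hbase hlip hdA hdB hop hinsRate
    hins hsrc hPiece hLev hKp hO1 hwt hΛ hδ hθ0 hθ1 hθθ' hθ'1.le hreach ((lt_div_iff₀ hc).2 (by linarith))⟩

end End

/-! ## §3 The `∃ C₅`-OUTERMOST face: one constant from the sizes, for every carrier, chart, frame, slots, pieces and pair of runs -/

section Uniform

/-- [folklore] **ONE NE5 CONSTANT FROM THE SIZES, UNIFORM IN EVERYTHING ELSE** — from `1 < L`, `0 ≤ Λ`, `0 ≤ δ + δ′`, `0 < θ < 1`,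
`θ ≤ θ′ ≤ 1`, the strict reach `(6L)⁴(EA₀ + E₀)∕(1 − L⁻¹) < ρ₀` and the smallness `Λ < (θ′ − L⁻¹)∕(6L)⁴` ALONE, a constant `C₅`
such that for EVERY carrier package `C`, nonempty chart `𝒰` with a map `ρ` ONTO the run-B backgrounds, history frame `F`, operator
space `Op`, per-background slots `P`, piece data `Pc` with output indexing `out`, window `W`, pair of runs `EA ∕ EB`, decay rate `κ`
and NE9 letters `κ₁, d0, O1, Kp` meeting part 2's displayed binders (VERBATIM, as an arrow chain), `T4OutputRate.NE5 EA EB W κ θ′ C₅`.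
The constant is part 2's `(Λ(δ + δ′) + B)(θ′ − L⁻¹)∕(θ′ − (L⁻¹ + Λ(6L)⁴))` at the letters `k₀, B` of `reach_binders_exists`, which
depend on the sizes only.  NOT a proof of NE5 ∕ NE9. -/
theorem uniform_ne5_of_pointwiseSlots_pieceChannel_lip {L Λ EA₀ E₀ δ δ' θ θ' ρ₀ : ℝ} (hL : 1 < L) (hΛ : 0 ≤ Λ) (hδ : 0 ≤ δ + δ')
    (hθ0 : 0 < θ) (hθ1 : θ < 1) (hθθ' : θ ≤ θ') (hθ'1 : θ' ≤ 1) (hreach : (6 * L) ^ 4 * (EA₀ + E₀) / (1 - L⁻¹) < ρ₀)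
    (hsmall : Λ < (θ' - L⁻¹) / (6 * L) ^ 4) :
    ∃ C₅ : ℝ, ∀ {C : Carriers} {𝒰 ι : Type} [Nonempty 𝒰] {F : HistFrame C} {α β γ : Type} {Op : Type*} [NormedAddCommGroup Op]
      [NormedSpace ℂ Op] (P : PointwiseSlots C 𝒰 Op (Hist F)) {Pc : PieceData C 𝒰 ι α β γ} {out : 𝒰 → F.Idx → ι}
      {W : Set (ℕ → ℝ)} {ρ : 𝒰 → C.BgB} (_ : Surjective ρ) {EA : Functional C C.BgA} {EB : Functional C C.BgB}
      {κ κ₁ d0 O1 : ℝ} {Kp : ℕ → ι → ℝ},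
      (∀ g ∈ W, ∀ k, BddAbove (Set.range fun u => ‖P.insA g k (uncurry (funTableA ρ EA g)) u‖)) →
      (∀ g ∈ W, ∀ k, BddAbove (Set.range fun u => ‖P.insB g k (uncurry (funTableB ρ EB g)) u‖)) →
      (∀ g ∈ W, ∀ (X : C.Dom) (u : 𝒰), EA g (C.transport (ρ u)) X =
        (P.Out (C.scale X) (P.opA g (C.scale X) u) (P.insA g (C.scale X) (uncurry (funTableA ρ EA g)) u) X).re) →
      (∀ g ∈ W, ∀ (X : C.Dom) (u : 𝒰), EB g (ρ u) X =
        (P.Out (C.scale X) (P.opB g (C.scale X) u) (P.insB g (C.scale X) (uncurry (funTableB ρ EB g)) u) X).re) →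
      (∀ k, ∀ g ∈ W, ∀ u, (P.opB g k u, P.insB g k (uncurry (funTableB ρ EB g)) u) ∈ P.Base k g u) →
      P.toStepModel.DataLipschitz W κ Λ ρ₀ → DecayBound EA W EA₀ κ → DecayBound EB W E₀ κ →
      (∀ k, ∀ g ∈ W, ∀ u : 𝒰, ‖P.opA g k u - P.opB g k u‖ ≤ δ * θ ^ k * P.rOp k) →
      (∀ k, ∀ g ∈ W, ∀ (t : C.Dom × 𝒰 → ℝ), (∀ Y u, |t (Y, u)| ≤ E₀ * Real.exp (-(κ * C.d Y))) →
        ∀ u, ‖P.insA g k t u - P.insB g k t u‖ ≤ δ' * θ ^ k * P.rHist k) →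
      (∀ k, ∀ g ∈ W, ∀ (t : C.Dom × 𝒰 → ℝ) (u : 𝒰), P.insA g k t u = insAtOfChannel (pieceChannel Pc) out g k t u) →
      SrcScale Pc → PieceBound Pc κ κ₁ d0 Kp (ellPrinted L) → LevelCounts Pc κ κ₁ O1 L (ellPrinted L) →
      (∀ k y, 0 ≤ Kp k y) → 0 ≤ O1 → (∀ k u i, weightOf Pc κ₁ d0 O1 Kp k (out u i) ≤ P.rHist (k + 1) * F.wt i) →
      NE5 EA EB W κ θ' C₅ := by
  obtain ⟨k₀, B, hB, hnear, hfirst⟩ := reach_binders_exists (D := δ + δ') (θ := θ) hδ hθ0 hθ1 hreach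
  refine ⟨(Λ * (δ + δ') + B) * (θ' - L⁻¹) / (θ' - (L⁻¹ + Λ * (6 * L) ^ 4)), ?_⟩
  intro C 𝒰 ι _ F α β γ Op _ _ P Pc out W ρ hρ EA EB κ κ₁ d0 O1 Kp hbdA hbdB hrA hrB hbase hlip hdA hdB hop hinsRate hins hsrc
    hPiece hLev hKp hO1 hwt
  exact ne5_of_pointwiseSlots_pieceChannel_lip_nat P hρ hL hbdA hbdB hrA hrB hbase hlip hdA hdB hop hinsRate hins hsrc hPiece hLev
    hKp hO1 hwt hΛ hδ hθ0.le hθθ' hθ'1 hnear hB hfirst hsmall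

end Uniform

/-! ## §4 Part 4's Road-D END through the LINEAR-EXTENSION insertion (FIBRE road, general letters `c, ω`), letters eliminated -/

section Linear

variable {C : Carriers} {𝒰 ι : Type} {F : HistFrame C}
variable {T : ℕ → (ℕ → ℝ) → (𝒰 → C.Dom → ℝ) → ι → ℝ}
variable (hadd : ChannelAdditive (Set.univ : Set (𝒰 → C.Dom → ℝ)) T) (hhom : ChannelHomog (Set.univ : Set (𝒰 → C.Dom → ℝ)) T)
  (out : 𝒰 → F.Idx → ι)
variable {Op : Type*} [NormedAddCommGroup Op] [NormedSpace ℂ Op] (P : PointwiseSlots C 𝒰 Op (Hist F)) {W : Set (ℕ → ℝ)}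

/-- [folklore] **PART 4's ROAD-D END THROUGH THE LINEAR-EXTENSION INSERTION, ARITHMETIC LETTERS ELIMINATED** — leaf-06-g12's
`InsertionChannelFamily.ne5_of_pointwiseSlots_insLin_fibre_scale_nat` (p229246; FIBRE road: the two fibre envelopes `OpFibreEnvelope ∕
HistFibreEnvelope` of constant `G`, general channel letters `c, ω`) with its FIVE binders over `ρ₀, k₀, B` — `hρ₀ : ρ₀ < 1`,
`hnear : (δ + δ′)·θ^{k₀} + c(EA₀ + E₀)∕(1 − ω) ≤ ρ₀`, `hB`, `hfirst`, `hsmall : ω + G∕(1 − ρ₀)·c < θ′` — REPLACED by `0 < θ < 1`, `ω < 1`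
and the TWO STRICT SIZE INEQUALITIES `c(EA₀ + E₀) < 1 − ω`, `ω + G·c·(1 − ω)∕(1 − ω − c(EA₀ + E₀)) < θ′` (this lineage's
`B13StepEndArithmetic.reach_elim_iff` + `OutputRateArithmetic.reach_binders_exists` BY NAME); every other binder VERBATIM (representation at
every chart point, admissibility, the fibre envelopes, decay levels, W1 `hop`, W4 `hinsRate`, the insertion IS `insLinOfChannel hadd hhom out`,
locality ∕ step-sum ∕ size binder of the channel `T`, weight dictionary, profile `τ ≤ c·ω^{k−j}`).  `∃ C₅, NE5 EA EB W κ θ′ C₅` over the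
ORIGINAL carriers.  NOT a proof of NE5 ∕ NE9. -/
theorem exists_ne5_of_pointwiseSlots_insLin_fibre_scale [Nonempty 𝒰] {ρ : 𝒰 → C.BgB} (hρ : Surjective ρ) {EA : Functional C C.BgA}
    {EB : Functional C C.BgB} {κ c ω G EA₀ E₀ δ δ' θ θ' : ℝ} {wt : ℕ → ι → ℝ} {τ : ℕ → ℕ → ℝ}
    (hbdA : ∀ g ∈ W, ∀ k, BddAbove (Set.range fun u => ‖P.insA g k (uncurry (funTableA ρ EA g)) u‖))
    (hbdB : ∀ g ∈ W, ∀ k, BddAbove (Set.range fun u => ‖P.insB g k (uncurry (funTableB ρ EB g)) u‖))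
    (hrA : ∀ g ∈ W, ∀ (X : C.Dom) (u : 𝒰), EA g (C.transport (ρ u)) X =
      (P.Out (C.scale X) (P.opA g (C.scale X) u) (P.insA g (C.scale X) (uncurry (funTableA ρ EA g)) u) X).re)
    (hrB : ∀ g ∈ W, ∀ (X : C.Dom) (u : 𝒰), EB g (ρ u) X =
      (P.Out (C.scale X) (P.opB g (C.scale X) u) (P.insB g (C.scale X) (uncurry (funTableB ρ EB g)) u) X).re)
    (hbase : ∀ k, ∀ g ∈ W, ∀ u, (P.opB g k u, P.insB g k (uncurry (funTableB ρ EB g)) u) ∈ P.Base k g u)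
    (hopF : P.toStepModel.OpFibreEnvelope W κ G) (hhistF : P.toStepModel.HistFibreEnvelope W κ G)
    (hdA : DecayBound EA W EA₀ κ) (hdB : DecayBound EB W E₀ κ)
    (hop : ∀ k, ∀ g ∈ W, ∀ u : 𝒰, ‖P.opA g k u - P.opB g k u‖ ≤ δ * θ ^ k * P.rOp k)
    (hinsRate : ∀ k, ∀ g ∈ W, ∀ (t : C.Dom × 𝒰 → ℝ), (∀ Y u, |t (Y, u)| ≤ E₀ * Real.exp (-(κ * C.d Y))) →
      ∀ u, ‖P.insA g k t u - P.insB g k t u‖ ≤ δ' * θ ^ k * P.rHist k)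
    (hins : ∀ k, ∀ g ∈ W, ∀ (t : C.Dom × 𝒰 → ℝ) (u : 𝒰), P.insA g k t u = insLinOfChannel hadd hhom out g k t u)
    (hloc : ChannelLocal (Set.univ : Set (𝒰 → C.Dom → ℝ)) T) (hsum : ChannelStepSum (Set.univ : Set (𝒰 → C.Dom → ℝ)) T)
    (hsize : ChannelSizeAtStepNN (Set.univ : Set (𝒰 → C.Dom → ℝ)) T κ wt τ) (hwt0 : ∀ k u i, 0 ≤ wt k (out u i))
    (hwt : ∀ k u i, wt k (out u i) ≤ P.rHist (k + 1) * F.wt i) (hτ : ∀ k j, j ≤ k → τ k j ≤ c * ω ^ (k - j))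
    (hG : 0 ≤ G) (hδ : 0 ≤ δ + δ') (hθ0 : 0 < θ) (hθ1 : θ < 1) (hθθ' : θ ≤ θ') (hθ'1 : θ' ≤ 1) (hc : 0 ≤ c) (hω : 0 < ω)
    (hω1 : ω < 1) (hh : c * (EA₀ + E₀) < 1 - ω) (hsmall : ω + G * c * (1 - ω) / (1 - ω - c * (EA₀ + E₀)) < θ') :
    ∃ C₅, NE5 EA EB W κ θ' C₅ := by
  obtain ⟨ρ₀, hreach, hρ₀, hs⟩ := (reach_elim_iff (mul_nonneg hG hc) hω1).mpr ⟨hh, hsmall⟩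
  obtain ⟨k₀, B, hB, hnear, hfirst⟩ := reach_binders_exists hδ hθ0 hθ1 hreach
  exact ⟨_, ne5_of_pointwiseSlots_insLin_fibre_scale_nat hadd hhom out P hρ hbdA hbdB hrA hrB hbase hopF hhistF hdA hdB hop hinsRate
    hins hloc hsum hsize hwt0 hwt hτ hG hδ hθ0.le hθθ' hθ'1 hc hω hρ₀ hnear hB hfirst (smallness_of_gain hs)⟩

/-- [folklore] **THE REACH FACE OF PART 4's END** (general profile `c`, damping `ω`): for EVERY input rate `0 < θ < 1`, the ONE letter-free
inequality `c·(G + EA₀ + E₀) < 1 − ω` (this lineage's `InsertionChannelEndArithmetic.rateWindow_nonempty_iff`) gives SOME target rate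
`θ′ < 1` with `θ ≤ θ′` and `∃ C₅, NE5 EA EB W κ θ′ C₅`; no `ρ₀, k₀, B, θ′` left. -/
theorem exists_rate_lt_one_of_pointwiseSlots_insLin_fibre_scale [Nonempty 𝒰] {ρ : 𝒰 → C.BgB} (hρ : Surjective ρ)
    {EA : Functional C C.BgA} {EB : Functional C C.BgB} {κ c ω G EA₀ E₀ δ δ' θ : ℝ} {wt : ℕ → ι → ℝ} {τ : ℕ → ℕ → ℝ}
    (hbdA : ∀ g ∈ W, ∀ k, BddAbove (Set.range fun u => ‖P.insA g k (uncurry (funTableA ρ EA g)) u‖))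
    (hbdB : ∀ g ∈ W, ∀ k, BddAbove (Set.range fun u => ‖P.insB g k (uncurry (funTableB ρ EB g)) u‖))
    (hrA : ∀ g ∈ W, ∀ (X : C.Dom) (u : 𝒰), EA g (C.transport (ρ u)) X =
      (P.Out (C.scale X) (P.opA g (C.scale X) u) (P.insA g (C.scale X) (uncurry (funTableA ρ EA g)) u) X).re)
    (hrB : ∀ g ∈ W, ∀ (X : C.Dom) (u : 𝒰), EB g (ρ u) X =
      (P.Out (C.scale X) (P.opB g (C.scale X) u) (P.insB g (C.scale X) (uncurry (funTableB ρ EB g)) u) X).re)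
    (hbase : ∀ k, ∀ g ∈ W, ∀ u, (P.opB g k u, P.insB g k (uncurry (funTableB ρ EB g)) u) ∈ P.Base k g u)
    (hopF : P.toStepModel.OpFibreEnvelope W κ G) (hhistF : P.toStepModel.HistFibreEnvelope W κ G)
    (hdA : DecayBound EA W EA₀ κ) (hdB : DecayBound EB W E₀ κ)
    (hop : ∀ k, ∀ g ∈ W, ∀ u : 𝒰, ‖P.opA g k u - P.opB g k u‖ ≤ δ * θ ^ k * P.rOp k)
    (hinsRate : ∀ k, ∀ g ∈ W, ∀ (t : C.Dom × 𝒰 → ℝ), (∀ Y u, |t (Y, u)| ≤ E₀ * Real.exp (-(κ * C.d Y))) →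
      ∀ u, ‖P.insA g k t u - P.insB g k t u‖ ≤ δ' * θ ^ k * P.rHist k)
    (hins : ∀ k, ∀ g ∈ W, ∀ (t : C.Dom × 𝒰 → ℝ) (u : 𝒰), P.insA g k t u = insLinOfChannel hadd hhom out g k t u)
    (hloc : ChannelLocal (Set.univ : Set (𝒰 → C.Dom → ℝ)) T) (hsum : ChannelStepSum (Set.univ : Set (𝒰 → C.Dom → ℝ)) T)
    (hsize : ChannelSizeAtStepNN (Set.univ : Set (𝒰 → C.Dom → ℝ)) T κ wt τ) (hwt0 : ∀ k u i, 0 ≤ wt k (out u i))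
    (hwt : ∀ k u i, wt k (out u i) ≤ P.rHist (k + 1) * F.wt i) (hτ : ∀ k j, j ≤ k → τ k j ≤ c * ω ^ (k - j))
    (hG : 0 ≤ G) (hδ : 0 ≤ δ + δ') (hθ0 : 0 < θ) (hθ1 : θ < 1) (hc : 0 ≤ c) (hω : 0 < ω) (hω1 : ω < 1)
    (h : c * (G + EA₀ + E₀) < 1 - ω) :
    ∃ θ' < 1, θ ≤ θ' ∧ ∃ C₅, NE5 EA EB W κ θ' C₅ := by
  obtain ⟨hh, hs⟩ := (rateWindow_nonempty_iff hω1 hc hG).2 h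
  obtain ⟨θ', h1, h2⟩ := exists_between (max_lt hθ1 hs)
  exact ⟨θ', h2, (le_max_left _ _).trans h1.le, exists_ne5_of_pointwiseSlots_insLin_fibre_scale hadd hhom out P hρ hbdA hbdB hrA
    hrB hbase hopF hhistF hdA hdB hop hinsRate hins hloc hsum hsize hwt0 hwt hτ hG hδ hθ0 hθ1 ((le_max_left _ _).trans h1.le) h2.le
    hc hω hω1 hh ((le_max_right _ _).trans_lt h1)⟩

end Linear

section LinearUniform

/-- [folklore] **ONE NE5 CONSTANT FROM THE SIZES ON PART 4's ROAD, UNIFORM IN EVERYTHING ELSE** — from `0 ≤ G`, `0 ≤ δ + δ′`,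
`0 < θ < 1`, `θ ≤ θ′ ≤ 1`, `0 ≤ c`, `0 < ω < 1` and the two strict size inequalities `c(EA₀ + E₀) < 1 − ω`,
`ω + G·c·(1 − ω)∕(1 − ω − c(EA₀ + E₀)) < θ′` ALONE, a constant `C₅` such that for EVERY carrier package `C`, nonempty chart `𝒰` with a
map `ρ` ONTO the run-B backgrounds, frame `F`, channel `T` (additive, homogeneous) with output indexing `out`, operator space `Op`,
per-background slots `P`, window `W`, pair of runs `EA ∕ EB`, decay rate `κ` and weight data `wt, τ` meeting part 4's displayed binders
(VERBATIM, as an arrow chain), `T4OutputRate.NE5 EA EB W κ θ′ C₅`.  The constant is part 4's at the letters `ρ₀` of `reach_elim_iff` and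
`k₀, B` of `reach_binders_exists`, which depend on the sizes only.  NOT a proof of NE5 ∕ NE9. -/
theorem uniform_ne5_of_pointwiseSlots_insLin_fibre_scale {c ω G EA₀ E₀ δ δ' θ θ' : ℝ} (hG : 0 ≤ G) (hδ : 0 ≤ δ + δ') (hθ0 : 0 < θ)
    (hθ1 : θ < 1) (hθθ' : θ ≤ θ') (hθ'1 : θ' ≤ 1) (hc : 0 ≤ c) (hω : 0 < ω) (hω1 : ω < 1) (hh : c * (EA₀ + E₀) < 1 - ω)
    (hsmall : ω + G * c * (1 - ω) / (1 - ω - c * (EA₀ + E₀)) < θ') :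
    ∃ C₅ : ℝ, ∀ {C : Carriers} {𝒰 ι : Type} [Nonempty 𝒰] {F : HistFrame C} {T : ℕ → (ℕ → ℝ) → (𝒰 → C.Dom → ℝ) → ι → ℝ}
      (hadd : ChannelAdditive (Set.univ : Set (𝒰 → C.Dom → ℝ)) T) (hhom : ChannelHomog (Set.univ : Set (𝒰 → C.Dom → ℝ)) T)
      (out : 𝒰 → F.Idx → ι) {Op : Type*} [NormedAddCommGroup Op] [NormedSpace ℂ Op] (P : PointwiseSlots C 𝒰 Op (Hist F))
      {W : Set (ℕ → ℝ)} {ρ : 𝒰 → C.BgB} (_ : Surjective ρ) {EA : Functional C C.BgA} {EB : Functional C C.BgB} {κ : ℝ}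
      {wt : ℕ → ι → ℝ} {τ : ℕ → ℕ → ℝ},
      (∀ g ∈ W, ∀ k, BddAbove (Set.range fun u => ‖P.insA g k (uncurry (funTableA ρ EA g)) u‖)) →
      (∀ g ∈ W, ∀ k, BddAbove (Set.range fun u => ‖P.insB g k (uncurry (funTableB ρ EB g)) u‖)) →
      (∀ g ∈ W, ∀ (X : C.Dom) (u : 𝒰), EA g (C.transport (ρ u)) X =
        (P.Out (C.scale X) (P.opA g (C.scale X) u) (P.insA g (C.scale X) (uncurry (funTableA ρ EA g)) u) X).re) →
      (∀ g ∈ W, ∀ (X : C.Dom) (u : 𝒰), EB g (ρ u) X =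
        (P.Out (C.scale X) (P.opB g (C.scale X) u) (P.insB g (C.scale X) (uncurry (funTableB ρ EB g)) u) X).re) →
      (∀ k, ∀ g ∈ W, ∀ u, (P.opB g k u, P.insB g k (uncurry (funTableB ρ EB g)) u) ∈ P.Base k g u) →
      P.toStepModel.OpFibreEnvelope W κ G → P.toStepModel.HistFibreEnvelope W κ G → DecayBound EA W EA₀ κ → DecayBound EB W E₀ κ →
      (∀ k, ∀ g ∈ W, ∀ u : 𝒰, ‖P.opA g k u - P.opB g k u‖ ≤ δ * θ ^ k * P.rOp k) →
      (∀ k, ∀ g ∈ W, ∀ (t : C.Dom × 𝒰 → ℝ), (∀ Y u, |t (Y, u)| ≤ E₀ * Real.exp (-(κ * C.d Y))) →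
        ∀ u, ‖P.insA g k t u - P.insB g k t u‖ ≤ δ' * θ ^ k * P.rHist k) →
      (∀ k, ∀ g ∈ W, ∀ (t : C.Dom × 𝒰 → ℝ) (u : 𝒰), P.insA g k t u = insLinOfChannel hadd hhom out g k t u) →
      ChannelLocal (Set.univ : Set (𝒰 → C.Dom → ℝ)) T → ChannelStepSum (Set.univ : Set (𝒰 → C.Dom → ℝ)) T →
      ChannelSizeAtStepNN (Set.univ : Set (𝒰 → C.Dom → ℝ)) T κ wt τ → (∀ k u i, 0 ≤ wt k (out u i)) →
      (∀ k u i, wt k (out u i) ≤ P.rHist (k + 1) * F.wt i) → (∀ k j, j ≤ k → τ k j ≤ c * ω ^ (k - j)) →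
      NE5 EA EB W κ θ' C₅ := by
  obtain ⟨ρ₀, hreach, hρ₀, hs⟩ := (reach_elim_iff (mul_nonneg hG hc) hω1).mpr ⟨hh, hsmall⟩
  obtain ⟨k₀, B, hB, hnear, hfirst⟩ := reach_binders_exists hδ hθ0 hθ1 hreach
  refine ⟨(G / (1 - ρ₀) * (δ + δ') + B) * (θ' - ω) / (θ' - (ω + G / (1 - ρ₀) * c)), ?_⟩
  intro C 𝒰 ι _ F T hadd hhom out Op _ _ P W ρ hρ EA EB κ wt τ hbdA hbdB hrA hrB hbase hopF hhistF hdA hdB hop hinsRate hins hloc hsum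
    hsize hwt0 hwt hτ
  exact ne5_of_pointwiseSlots_insLin_fibre_scale_nat hadd hhom out P hρ hbdA hbdB hrA hrB hbase hopF hhistF hdA hdB hop hinsRate hins
    hloc hsum hsize hwt0 hwt hτ hG hδ hθ0.le hθθ' hθ'1 hc hω hρ₀ hnear hB hfirst (smallness_of_gain hs)

end LinearUniform

end Summit.QuantumFields.BalabanUV.T4Continuum.InsertionChannelFamilyArithmetic

end
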